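import Summits.BirchSwinnertonDyer.BirchSwinnertonDyer.Theorems.AdditiveBranchIMCTamePartnerData
import Literature.NumberTheory.EllipticCurves.PAdicLFunctionQuadraticTwistBirchSharedPrimesProofs
import Literature.NumberTheory.EllipticCurves.RootNumberTwistSemistableProofs
import Literature.NumberTheory.EllipticCurves.BSDRootNumberLocalTablesProofs
import HarnessLib

/-!
# Route `AdditiveBranchIMC` (rung K1), crux 19357 `GordTwoRankZeroOffCaseOne`, line `three_field_road`: the SEMISTABLE PARTNER
# of a curve whose additive primes other than `p` are of QUADRATIC-TWIST TYPE (LEAD g13; toward the sub-row without the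
# «semistable outside `p`» clause)

Cell `bsd-addord`, LEAD seat `cruxlead-19357` (gen 13), `Cruxes/GordTwoRankZeroOffCaseOne/LeadReport21.md`. THEOREMS ONLY (no
definition, no named fact, no `sorry`). On the three-field road the clause «`E` semistable outside `p`» of the tame sub-row is consumed
in exactly ONE place of the kernel: the good-ordinary partner `V ≅ E^{(p*)}` must have SQUARE-FREE level for the printed two-variable
divisibility (Castella–Liu–Wan 2022 §5.2: `π_v` unramified or Steinberg at every finite `v`; `TamePartnerData.exists_partner_data`). When the
other additive primes `ℓ ≠ p` of `E` are of quadratic-twist type (`E^{(ℓ*)}` semistable at `ℓ`; on the cell these are the Kodaira types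
`I₀*`, `Iₙ*` at `ℓ ≥ 5`), the curve `V₀ ≅ E^{(p*·d)}` with `d = ∏ ℓ*` over those primes IS semistable, good at `p`, has the same big image, and
keeps the Wan prime as a Steinberg prime; the twist parameter `d ≡ 1 (mod 4)` is prime to `p` and supported on primes of `N_E` other than
`q`. This is the partner the generalised reading of CLW Thm. 8.2.1 (free branch character `ξ ⊇ χ_d ∘ N`) consumes.

* `exists_semistable_partner_data` — `V₀` globally minimal, `C • E^{(p*·d)} = V₀`, `d % 4 = 1`, `p ∤ d`, every prime of `d` divides
  `N_E` and is `≠ q`, `Squarefree N_{V₀}`, `p ∤ N_{V₀}`, `Surj V₀ p`, `q ∣ N_{V₀}`, `2 ∣ N_E → 2 ∣ N_{V₀}`.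

Bookkeeping on tree theorems: reduction types through a twist by a `v`-adic unit (`hasReductionAt_quadraticTwist_iff_of_not_dvd`),
conductor exponents through a twist by `D ≡ 1 (mod 4)` at `v ∤ D` (`factorization_conductorNorm_quadraticTwist_eq_of_not_dvd`),
`f_v ≥ 2 ⟺` additive (`natGenerator_sq_dvd_conductorNorm_iff`), `f_v ≥ 1 ⟺` bad (`natGenerator_dvd_conductorNorm_iff`), `E^{(p*)}` good
at `p` on the cell (`goodOrd_twist_pStar_of_typeGOrd`), big image through a twist (`Additive.surj_iff_of_model_twist`), `(W^{a})^{b} = W^{ab}`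
(`quadraticTwist_quadraticTwist`).
References: F. Castella, Z. Liu, X. Wan, Forum Math. Sigma 10 (2022) e110, §5.2; J. H. Silverman, *AEC* VII.5 Prop. 5.1, X.5 Cor. 5.4;
*ATAEC* IV.10.2.
-/

set_option linter.dupNamespace false
set_option autoImplicit false

noncomputable section

open scoped Classical

open WeierstrassCurve NumberField IsDedekindDomain Rat.HeightOneSpectrum
  Literature.NumberTheory.EllipticCurves Literature.NumberTheory.EllipticCurves.ModularForms
  Literature.NumberTheory.EllipticCurves.Rank1Residual
  Summit.BirchSwinnertonDyer.Rank1Residual Summit.BirchSwinnertonDyer.Rank1Residual.Additive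

namespace Summit.BirchSwinnertonDyer.BirchSwinnertonDyer.Theorems.TwistTypePartnerData

variable (W : WeierstrassCurve ℚ) [W.IsElliptic] [W.IsGloballyMinimal] (p : ℕ) [hp : Fact p.Prime]

/-- `natGenerator` of the place of `ℤ` under a prime is that prime. [folklore] -/
private theorem natGenerator_symm (r : Nat.Primes) : natGenerator ((primesEquiv (R := ℤ)).symm r) = r :=
  congrArg (fun r : Nat.Primes ↦ (r : ℕ)) ((primesEquiv (R := ℤ)).apply_symm_apply r)

/-- `ℓ* = (−1)^{(ℓ−1)/2} ℓ ≡ 1 (mod 4)` for an odd prime `ℓ`. [folklore] -/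
private theorem star_emod_four {ℓ : ℕ} (hℓ : ℓ.Prime) (hℓ2 : ℓ ≠ 2) : ((-1 : ℤ) ^ (ℓ / 2) * ℓ) % 4 = 1 := by
  haveI : Fact ℓ.Prime := ⟨hℓ⟩
  exact AdditiveKoly.RamifiedHabitat.pStar_emod_four (p := ℓ) hℓ2

/-- A product of integers `≡ 1 (mod 4)` is `≡ 1 (mod 4)`. [folklore] -/
private theorem prod_emod_four {ι : Type*} (S : Finset ι) (f : ι → ℤ) (hf : ∀ i ∈ S, f i % 4 = 1) :
    (∏ i ∈ S, f i) % 4 = 1 := by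
  induction S using Finset.induction_on with
  | empty => simp
  | insert a S ha ih =>
    rw [Finset.prod_insert ha, Int.mul_emod, hf a (Finset.mem_insert_self a S),
      ih (fun i hi ↦ hf i (Finset.mem_insert_of_mem hi))]
    norm_num

/-- **The semistable partner of a curve whose additive primes other than `p` are of quadratic-twist type.** Let `E/ℚ` (globally
minimal `W`) lie on the cell (G-ord, `e = 2`) at `p ≥ 5` with `ρ̄_{E,p}` onto, NO additive reduction above `2, 3` (`h23`) and every
additive prime `ℓ ≥ 5` of quadratic-twist type (`htw`: `E^{(ℓ*)}` is not additive at `ℓ`), and let `q ≠ p` be a prime of multiplicative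
reduction. Then for `d := ∏ ℓ*` over the additive primes `ℓ ≠ p` of `E` there is a globally minimal `V₀` with `C • E^{(p*·d)} = V₀`,
`d ≡ 1 (mod 4)`, `p ∤ d`, every prime of `d` divides `N_E` and is `≠ q`, `N_{V₀}` SQUARE-FREE, `p ∤ N_{V₀}`, `ρ̄_{V₀,p}` onto, `q ∣ N_{V₀}`,
and `2 ∣ N_E → 2 ∣ N_{V₀}`. [cite: CastellaLiuWan2022, §5.2 «Our setup» (Forum Math. Sigma 10 (2022) e110)]
[cite: SilvermanAEC2009, VII.5 Prop. 5.1; X.5 Cor. 5.4] [cite: Silverman1994, IV.10.2] -/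
theorem exists_semistable_partner_data (hp5 : 5 ≤ p) (hcell : N10.CellGordTwo W p) (hsurj : Surj W p)
    (h23 : ∀ v : HeightOneSpectrum ℤ, W.HasAdditiveReductionAt v → 3 < ringChar (ℤ ⧸ v.asIdeal))
    (htw : ∀ r : Nat.Primes, 5 ≤ (r : ℕ) → W.HasAdditiveReductionAt ((primesEquiv (R := ℤ)).symm r) →
      ¬ (W.quadraticTwist (((-1 : ℤ) ^ ((r : ℕ) / 2) * r : ℤ) : ℚ)).HasAdditiveReductionAt
        ((primesEquiv (R := ℤ)).symm r))
    {q : ℕ} [hq : Fact q.Prime] (hqp : q ≠ p) (hmq : W.HasMultiplicativeReductionAtPrime q) :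
    ∃ (V : WeierstrassCurve ℚ) (_ : V.IsElliptic) (_ : V.IsGloballyMinimal) (C : VariableChange ℚ) (d : ℤ),
      C • W.quadraticTwist ((-1 : ℚ) ^ (p / 2) * p * d) = V ∧ d % 4 = 1 ∧ ¬ (p : ℤ) ∣ d ∧
      (∀ ℓ : ℕ, ℓ.Prime → (ℓ : ℤ) ∣ d → ℓ ∣ W.conductorNorm ℤ ∧ ℓ ≠ q) ∧
      Squarefree (V.conductorNorm ℤ) ∧ ¬ p ∣ V.conductorNorm ℤ ∧ Surj V p ∧ q ∣ V.conductorNorm ℤ ∧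
      (2 ∣ W.conductorNorm ℤ → 2 ∣ V.conductorNorm ℤ) := by
  have hpr : p.Prime := hp.out
  have hqr : q.Prime := hq.out
  have hp2 : p ≠ 2 := by omega
  set N := W.conductorNorm ℤ with hN
  have hN0 : N ≠ 0 := (W.conductorNorm_pos_holds).ne'
  -- the additive primes other than `p`, read off the conductor: `ℓ ≠ p`, `ℓ² ∣ N`
  set S : Finset ℕ := N.primeFactors.filter (fun ℓ ↦ ℓ ≠ p ∧ ℓ ^ 2 ∣ N) with hS
  have hSmem : ∀ {ℓ : ℕ}, ℓ ∈ S ↔ ℓ.Prime ∧ ℓ ∣ N ∧ ℓ ≠ p ∧ ℓ ^ 2 ∣ N := by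
    intro ℓ
    rw [hS, Finset.mem_filter, Nat.mem_primeFactors]
    constructor
    · rintro ⟨⟨h1, h2, -⟩, h3, h4⟩; exact ⟨h1, h2, h3, h4⟩
    · rintro ⟨h1, h2, h3, h4⟩; exact ⟨⟨h1, h2, hN0⟩, h3, h4⟩
  -- every `ℓ ∈ S` is an additive prime `≥ 5`
  have hSadd : ∀ {ℓ : ℕ} (hℓ : ℓ ∈ S),
      W.HasAdditiveReductionAt ((primesEquiv (R := ℤ)).symm ⟨ℓ, (hSmem.mp hℓ).1⟩) := by
    intro ℓ hℓ
    have h := hSmem.mp hℓ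
    rw [← natGenerator_sq_dvd_conductorNorm_iff _ W, natGenerator_symm]
    exact h.2.2.2
  have hS5 : ∀ {ℓ : ℕ}, ℓ ∈ S → 5 ≤ ℓ := by
    intro ℓ hℓ
    have hprime := (hSmem.mp hℓ).1
    have h3 := h23 _ (hSadd hℓ)
    rw [Rat.ringChar_int_quotient_asIdeal, natGenerator_symm] at h3
    have h4 : ℓ ≠ 4 := fun h ↦ by rw [h] at hprime; exact absurd hprime (by decide)
    simp only at h3
    omega
  have hS2 : ∀ {ℓ : ℕ}, ℓ ∈ S → ℓ ≠ 2 := fun hℓ ↦ by have := hS5 hℓ; omega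
  -- the twist parameters
  set star : ℕ → ℤ := fun ℓ ↦ (-1 : ℤ) ^ (ℓ / 2) * ℓ with hstar
  set d : ℤ := ∏ ℓ ∈ S, star ℓ with hd
  set D : ℤ := star p * d with hD
  have hstar' : ∀ ℓ : ℕ, star ℓ = (-1 : ℤ) ^ (ℓ / 2) * ℓ := fun ℓ ↦ rfl
  have hstar0 : ∀ {ℓ : ℕ}, ℓ.Prime → star ℓ ≠ 0 := fun hℓ ↦ by
    rw [hstar']; exact mul_ne_zero (pow_ne_zero _ (by norm_num)) (by exact_mod_cast hℓ.ne_zero)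
  have hdvd_self : ∀ ℓ : ℕ, (ℓ : ℤ) ∣ star ℓ := fun ℓ ↦ by rw [hstar']; exact dvd_mul_left _ _
  have hdD : d ∣ D := by rw [hD]; exact dvd_mul_left d (star p)
  have hpD : (p : ℤ) ∣ D := by rw [hD]; exact (hdvd_self p).trans (dvd_mul_right _ _)
  have hd4 : d % 4 = 1 := prod_emod_four S star (fun ℓ hℓ ↦ star_emod_four (hSmem.mp hℓ).1 (hS2 hℓ))
  have hD4 : D % 4 = 1 := by
    rw [hD, Int.mul_emod, star_emod_four hpr hp2, hd4]; norm_num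
  have hd0 : d ≠ 0 := Finset.prod_ne_zero_iff.mpr (fun ℓ hℓ ↦ hstar0 (hSmem.mp hℓ).1)
  have hD0 : D ≠ 0 := mul_ne_zero (hstar0 hpr) hd0
  have hDQ : (D : ℚ) ≠ 0 := by exact_mod_cast hD0
  -- prime divisors of `d` lie in `S`; prime divisors of `D` lie in `S ∪ {p}`
  have hdvd_star : ∀ {ℓ ℓ' : ℕ}, ℓ.Prime → ℓ'.Prime → (ℓ : ℤ) ∣ star ℓ' → ℓ = ℓ' := by
    intro ℓ ℓ' hℓ hℓ' h
    haveI : Fact ℓ'.Prime := ⟨hℓ'⟩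
    exact AdditiveKoly.RamifiedHabitat.eq_of_prime_dvd_pStar (p := ℓ') hℓ h
  have hdvd_d : ∀ {ℓ : ℕ}, ℓ.Prime → (ℓ : ℤ) ∣ d → ℓ ∈ S := by
    intro ℓ hℓ h
    have hℓZ : Prime (ℓ : ℤ) := Nat.prime_iff_prime_int.mp hℓ
    obtain ⟨ℓ', hℓ'S, hℓ'⟩ := (Prime.dvd_finsetProd_iff hℓZ _).mp h
    rwa [hdvd_star hℓ (hSmem.mp hℓ'S).1 hℓ']
  have hdvd_D : ∀ {ℓ : ℕ}, ℓ.Prime → (ℓ : ℤ) ∣ D → ℓ = p ∨ ℓ ∈ S := by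
    intro ℓ hℓ h
    have hℓZ : Prime (ℓ : ℤ) := Nat.prime_iff_prime_int.mp hℓ
    rcases hℓZ.dvd_or_dvd h with h | h
    · exact Or.inl (hdvd_star hℓ hpr h)
    · exact Or.inr (hdvd_d hℓ h)
  have hpd : ¬ (p : ℤ) ∣ d := fun h ↦ (hSmem.mp (hdvd_d hpr h)).2.2.1 rfl
  -- the twisted curve and its conductor exponents
  haveI iT : (W.quadraticTwist (D : ℚ)).IsElliptic := W.isElliptic_quadraticTwist hDQ
  set NT := (W.quadraticTwist (D : ℚ)).conductorNorm ℤ with hNT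
  have hNT0 : NT ≠ 0 := ((W.quadraticTwist (D : ℚ)).conductorNorm_pos_holds).ne'
  -- (a) at primes not dividing `D` the exponents of `E` and `E^{(D)}` agree
  have hfac : ∀ {ℓ : ℕ} (hℓ : ℓ.Prime), ¬ (ℓ : ℤ) ∣ D → NT.factorization ℓ = N.factorization ℓ := by
    intro ℓ hℓ hℓD
    have h := W.factorization_conductorNorm_quadraticTwist_eq_of_not_dvd hD4 ((primesEquiv (R := ℤ)).symm ⟨ℓ, hℓ⟩)
      (by rw [natGenerator_symm]; exact hℓD)
    rw [natGenerator_symm] at h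
    exact h
  -- (b) `E^{(D)}` is not additive at the primes of `S`
  have hnaddS : ∀ {ℓ : ℕ} (hℓ : ℓ ∈ S),
      ¬ (W.quadraticTwist (D : ℚ)).HasAdditiveReductionAt ((primesEquiv (R := ℤ)).symm ⟨ℓ, (hSmem.mp hℓ).1⟩) := by
    intro ℓ hℓ
    have hprime := (hSmem.mp hℓ).1
    set v := (primesEquiv (R := ℤ)).symm ⟨ℓ, hprime⟩ with hv
    -- `D = ℓ* · u` with `ℓ ∤ u`
    set u : ℤ := star p * ∏ ℓ' ∈ S.erase ℓ, star ℓ' with hu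
    have hDu : D = star ℓ * u := by
      rw [hD, hd, hu, ← Finset.mul_prod_erase S star hℓ]; ring
    have hℓu : ¬ (ℓ : ℤ) ∣ u := by
      intro h
      have hℓZ : Prime (ℓ : ℤ) := Nat.prime_iff_prime_int.mp hprime
      rcases hℓZ.dvd_or_dvd h with h | h
      · exact (hSmem.mp hℓ).2.2.1 (hdvd_star hprime hpr h)
      · obtain ⟨ℓ', hℓ'S, hℓ'⟩ := (Prime.dvd_finsetProd_iff hℓZ _).mp h
        have := hdvd_star hprime (hSmem.mp (Finset.mem_of_mem_erase hℓ'S)).1 hℓ'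
        exact (Finset.ne_of_mem_erase hℓ'S) this.symm
    have hstarQ : ((star ℓ : ℤ) : ℚ) ≠ 0 := by exact_mod_cast hstar0 hprime
    haveI : (W.quadraticTwist ((star ℓ : ℤ) : ℚ)).IsElliptic := W.isElliptic_quadraticTwist hstarQ
    have htwℓ := htw ⟨ℓ, hprime⟩ (hS5 hℓ) (hSadd hℓ)
    have hiff := ((W.quadraticTwist ((star ℓ : ℤ) : ℚ)).hasReductionAt_quadraticTwist_iff_of_not_dvd v
      (by rw [hv, natGenerator_symm]; exact hS2 hℓ) (d := u) (by rw [hv, natGenerator_symm]; exact hℓu)).2.2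
    have heq : (W.quadraticTwist ((star ℓ : ℤ) : ℚ)).quadraticTwist (u : ℚ) = W.quadraticTwist (D : ℚ) := by
      rw [quadraticTwist_quadraticTwist, hDu]; push_cast; ring
    rw [← heq, hiff]
    exact htwℓ
  -- (c) `E^{(D)}` is GOOD at `p`
  have hgoodp : (W.quadraticTwist (D : ℚ)).HasGoodReductionAt ((primesEquiv (R := ℤ)).symm ⟨p, hpr⟩) := by
    set v := (primesEquiv (R := ℤ)).symm ⟨p, hpr⟩ with hv
    obtain ⟨Wp, iWp, iWpm, Cp, hCp⟩ := exists_isGloballyMinimal_smul_eq_quadraticTwist W (pStar_ne_zero p)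
    have hWp : Cp⁻¹ • W.quadraticTwist ((-1 : ℚ) ^ (p / 2) * p) = Wp := by rw [← hCp, inv_smul_smul]
    have hgood : Wp.HasGoodReductionAtPrime p :=
      (goodOrd_twist_pStar_of_typeGOrd W p hp5 hcell.2.2.1 hcell.2.2.2 Wp ⟨Cp⁻¹, hWp⟩).1
    have hgood' : (W.quadraticTwist ((star p : ℤ) : ℚ)).HasGoodReductionAt v := by
      have hcast : ((star p : ℤ) : ℚ) = (-1 : ℚ) ^ (p / 2) * p := by rw [hstar']; push_cast; ring
      rw [hcast, ← hCp, hasGoodReductionAt_smul_iff_holds _ Wp Cp]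
      exact (Wp.hasGoodReductionAtPrime_iff_hasGoodReductionAt_holds ⟨p, hpr⟩).mp hgood
    have hstarQ : ((star p : ℤ) : ℚ) ≠ 0 := by exact_mod_cast hstar0 hpr
    haveI : (W.quadraticTwist ((star p : ℤ) : ℚ)).IsElliptic := W.isElliptic_quadraticTwist hstarQ
    have hiff := ((W.quadraticTwist ((star p : ℤ) : ℚ)).hasReductionAt_quadraticTwist_iff_of_not_dvd v
      (by rw [hv, natGenerator_symm]; exact hp2) (d := d) (by rw [hv, natGenerator_symm]; exact hpd)).1
    have heq : (W.quadraticTwist ((star p : ℤ) : ℚ)).quadraticTwist (d : ℚ) = W.quadraticTwist (D : ℚ) := by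
      rw [quadraticTwist_quadraticTwist, hD]; push_cast; ring
    rw [← heq, hiff]
    exact hgood'
  -- (d) hence every conductor exponent of `E^{(D)}` is `≤ 1`, and `f_p = 0`
  have hfacp : NT.factorization p = 0 := by
    have h : ¬ natGenerator ((primesEquiv (R := ℤ)).symm ⟨p, hpr⟩) ∣ NT :=
      fun h ↦ ((natGenerator_dvd_conductorNorm_iff _ (W.quadraticTwist (D : ℚ))).mp h) hgoodp
    rw [natGenerator_symm] at h
    exact Nat.factorization_eq_zero_of_not_dvd h
  have hle : ∀ ℓ : ℕ, NT.factorization ℓ ≤ 1 := by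
    intro ℓ
    by_cases hℓ : ℓ.Prime
    · by_cases hℓD : (ℓ : ℤ) ∣ D
      · rcases hdvd_D hℓ hℓD with rfl | hℓS
        · rw [hfacp]; exact zero_le_one
        · -- not additive at `ℓ ∈ S` ⟹ `ℓ² ∤ N_T`
          have hnsq : ¬ ℓ ^ 2 ∣ NT := by
            have h := (not_congr (natGenerator_sq_dvd_conductorNorm_iff ((primesEquiv (R := ℤ)).symm ⟨ℓ, hℓ⟩)
              (W.quadraticTwist (D : ℚ)))).mpr (hnaddS hℓS)
            rwa [natGenerator_symm] at h
          by_contra hgt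
          exact hnsq ((hℓ.pow_dvd_iff_le_factorization hNT0).mpr (by omega))
      · rw [hfac hℓ hℓD]
        -- `ℓ ∉ S ∪ {p}`: `E` is not additive at `ℓ`
        have hℓp : ℓ ≠ p := fun h ↦ hℓD (h ▸ hpD)
        have hℓS : ℓ ∉ S := fun hℓS ↦
          hℓD ((hdvd_self ℓ).trans ((Finset.dvd_prod_of_mem star hℓS).trans hdD))
        have hnsq : ¬ ℓ ^ 2 ∣ N := fun hsq ↦
          hℓS (hSmem.mpr ⟨hℓ, (dvd_pow_self ℓ two_ne_zero).trans hsq, hℓp, hsq⟩)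
        by_contra hgt
        exact hnsq ((hℓ.pow_dvd_iff_le_factorization hN0).mpr (by omega))
    · rw [Nat.factorization_eq_zero_of_not_prime _ hℓ]; exact zero_le_one
  have hsqT : Squarefree NT := (Nat.squarefree_iff_factorization_le_one hNT0).mpr hle
  -- `q ∉ S ∪ {p}`: `f_q(E^{(D)}) = f_q(E) = 1`
  have hq2N : ¬ q ^ 2 ∣ N := by
    rw [hqr.pow_dvd_iff_le_factorization hN0, W.factorization_conductorNorm_eq_one_of_hasMultiplicativeReductionAtPrime q hmq]
    omega
  have hqS : q ∉ S := fun h ↦ hq2N (hSmem.mp h).2.2.2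
  have hqD : ¬ (q : ℤ) ∣ D := fun h ↦ by
    rcases hdvd_D hqr h with h | h
    · exact hqp h
    · exact hqS h
  have hfacq : NT.factorization q = 1 := by
    rw [hfac hqr hqD, W.factorization_conductorNorm_eq_one_of_hasMultiplicativeReductionAtPrime q hmq]
  -- the globally minimal model
  obtain ⟨V, iV, iVm, C, hC⟩ := exists_isGloballyMinimal_smul_eq_quadraticTwist W hDQ
  have hNV : V.conductorNorm ℤ = NT := by rw [hNT, ← hC, conductorNorm_smul_rat]
  have hCV : C⁻¹ • W.quadraticTwist ((-1 : ℚ) ^ (p / 2) * p * d) = V := by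
    have hcast : (D : ℚ) = (-1 : ℚ) ^ (p / 2) * p * d := by rw [hD, hstar']; push_cast; ring
    rw [← hcast, ← hC, inv_smul_smul]
  refine ⟨V, iV, iVm, C⁻¹, d, hCV, hd4, hpd, ?_, ?_, ?_, ?_, ?_, ?_⟩
  · -- primes of `d`
    intro ℓ hℓ hℓd
    have hℓS := hdvd_d hℓ hℓd
    exact ⟨(hSmem.mp hℓS).2.1, fun h ↦ hqS (h ▸ hℓS)⟩
  · rw [hNV]; exact hsqT
  · rw [hNV]
    intro h
    have h1 := (hpr.dvd_iff_one_le_factorization hNT0).mp h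
    rw [hfacp] at h1
    exact absurd h1 (by norm_num)
  · have hcast : (D : ℚ) = (-1 : ℚ) ^ (p / 2) * p * d := by rw [hD, hstar']; push_cast; ring
    exact (surj_iff_of_model_twist W p (d := (-1 : ℚ) ^ (p / 2) * p * d) (by rw [← hcast]; exact hDQ) ⟨C⁻¹, hCV⟩).mpr hsurj
  · rw [hNV]; exact (hqr.dvd_iff_one_le_factorization hNT0).mpr (by rw [hfacq])
  · intro h2
    rw [hNV]
    have h2D : ¬ ((2 : ℕ) : ℤ) ∣ D := fun h ↦ by
      rcases hdvd_D Nat.prime_two h with h | h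
      · exact hp2 h.symm
      · exact hS2 h rfl
    have hf2 : NT.factorization 2 = N.factorization 2 := hfac Nat.prime_two h2D
    have h1 : 1 ≤ N.factorization 2 := (Nat.prime_two.dvd_iff_one_le_factorization hN0).mp h2
    exact (Nat.prime_two.dvd_iff_one_le_factorization hNT0).mpr (by rw [hf2]; exact h1)

end Summit.BirchSwinnertonDyer.BirchSwinnertonDyer.Theorems.TwistTypePartnerData

end
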